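import Mathlib
import HarnessLib
import Summits.AtomisticToContinuum.Crystallization.Theorems.PricedLinkCensusSoftLayerPropagationStubBallPropagationNumerics

/-!
# Local layer-propagation lemmas for the finite-ball form of Hales, *Dense Sphere Packings* §1.3 (XIII b):
# the three radius schedules, with the order of the radii recorded

Route `PricedLinkCensus`, crux `SoftLayerPropagation` (stmt-AtomisticToContinuum-14233), line
`Sketch`, helper file for the stub `stub_ballPropagation` (uses `…Numerics.lean`).  The schedule
lemmas of `…Numerics.lean` restated with the extra conjunct `P n ≤ R n` (the ring radius is at
least the disc radius, so that square roots of ring radii can be taken downstream); primed names,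
the tree being append-only.

All statements are elementary ([folklore]).
-/

noncomputable section

namespace Summit.AtomisticToContinuum.Crystallization.Theorems

open Literature.Geometry.DiscreteGeometry Literature.MathematicalPhysics.StatisticalMechanics
open RealInnerProductSpace

/-- **The schedule above the base (Case A).**  Radii `P n` (certified discs) and `R n` (rings) for
the layers `0 ≤ n ≤ 9` above an HCP base disc of radius `10.6`, with all the real-arithmetic facts
the reconstruction uses: the hypotheses of `layers_up` (`√2 ≤ P`, ring, parent, far corner, the
pattern ball `13` about the moved centre at height `a′𝗁`, `0 ≤ a′ ≤ 4.5931`, for the layers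
`n + 1 ≤ a′ + 5.2443` that meet the `8.564`-ball) and the coverage of the `8.564`-ball by the rings.
[folklore] -/
theorem exists_up_schedule' : ∃ P R : ℕ → ℝ, P 0 = 10.6 ∧
    (∀ n ≤ 9, Real.sqrt 2 ≤ P n ∧ P n ≤ R n) ∧
    (∀ n ≤ 9, ∀ r : ℝ, P n < r → r ≤ R n →
      ∃ t : ℝ, 0 < t ∧ 4 / 3 * t ^ 2 < r ^ 2 ∧ r ^ 2 - (4 * t - 4) ≤ P n ^ 2) ∧
    (∀ n < 9, ∀ r M : ℝ, 0 ≤ r → r ≤ P (n + 1) → 0 ≤ M → r ^ 2 ≤ 3 * M ^ 2 →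
      r ^ 2 - 2 * M + 4 / 3 ≤ P n ^ 2) ∧
    (∀ n < 9, P (n + 1) + 4 / Real.sqrt 3 ≤ R n) ∧
    (∀ n : ℕ, n < 9 → ∀ a x : ℝ, 0 ≤ a → a ≤ 4.5931 → (n : ℝ) + 1 ≤ a + 5.2443 → x ≤ P (n + 1) →
      0 ≤ x → x ^ 2 + 8 / 3 * ((n : ℝ) + 1 - a) ^ 2 ≤ 169) ∧
    (∀ k : ℕ, k ≤ 9 → ∀ a x : ℝ, 0 ≤ a → a ≤ 4.5931 → (k : ℝ) ≤ a + 5.2443 →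
      x + 8 / 3 * ((k : ℝ) - a) ^ 2 ≤ 73.34 → x ≤ R k ^ 2) := by
  refine ⟨fun n => (([10.6, 9.965, 9.327, 8.685, 8.039, 7.389, 6.733, 6.07, 5.399, 4.718] : List ℝ).getD n 0),
    fun n => (([12.279, 11.641, 11.0, 10.354, 9.703, 9.048, 8.385, 7.714, 7.032, 6.337] : List ℝ).getD n 0),
    by norm_num, ?_, ?_, ?_, ?_, ?_, ?_⟩
  · intro n hn
    have hs2 := sqrt_two_le
    constructor
    · interval_cases n <;> norm_num <;> linarith
    · interval_cases n <;> norm_num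
  · intro n hn
    refine ring_hyp_of ?_ ?_ (ring_ineq_of ?_ ?_) <;> interval_cases n <;> norm_num
  · intro n hn
    refine par_hyp_of ?_ ?_ <;> interval_cases n <;> norm_num
  · intro n hn
    refine far_of_gap ?_
    interval_cases n <;> norm_num
  · intro n hn a x ha0 ha hna hx hx0
    have hx2 : x ^ 2 ≤ (([10.6, 9.965, 9.327, 8.685, 8.039, 7.389, 6.733, 6.07, 5.399, 4.718] : List ℝ).getD (n + 1) 0) ^ 2 :=
      pow_le_pow_left₀ hx0 hx 2
    interval_cases n <;> norm_num at hx2 hna ⊢ <;> nlinarith [mul_nonneg ha0 (sub_nonneg.2 ha), mul_nonneg (sub_nonneg.2 hna) (sub_nonneg.2 ha), mul_nonneg (sub_nonneg.2 hna) ha0]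
  · intro k hk a x ha0 ha hka hx
    interval_cases k <;> norm_num at hka hx ⊢ <;> nlinarith [mul_nonneg ha0 (sub_nonneg.2 ha), mul_nonneg (sub_nonneg.2 hka) (sub_nonneg.2 ha), sq_nonneg ((k : ℝ) - a)]

/-- **The schedule below the base (Case A)**: radii for the layers `1 ≤ n ≤ 5` below the HCP base
disc (layer `−n`), with the hypotheses of `layers_down` and the coverage of the rings. [folklore] -/
theorem exists_down_schedule' : ∃ P R : ℕ → ℝ, P 0 = 10.6 ∧
    (∀ n ≤ 5, Real.sqrt 2 ≤ P n ∧ P n ≤ R n) ∧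
    (∀ n ≤ 5, ∀ r : ℝ, P n < r → r ≤ R n →
      ∃ t : ℝ, 0 < t ∧ 4 / 3 * t ^ 2 < r ^ 2 ∧ r ^ 2 - (4 * t - 4) ≤ P n ^ 2) ∧
    (∀ n < 5, ∀ r M : ℝ, 0 ≤ r → r ≤ P (n + 1) → 0 ≤ M → r ^ 2 ≤ 3 * M ^ 2 →
      r ^ 2 - 2 * M + 4 / 3 ≤ P n ^ 2) ∧
    (∀ n < 5, P (n + 1) + 4 / Real.sqrt 3 ≤ R n) ∧
    (∀ n : ℕ, n < 5 → ∀ a x : ℝ, 0 ≤ a → (n : ℝ) + 1 ≤ 5.2443 - a → x ≤ P (n + 1) →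
      0 ≤ x → x ^ 2 + 8 / 3 * ((n : ℝ) + 1 + a) ^ 2 ≤ 169) ∧
    (∀ k : ℕ, k ≤ 5 → ∀ a x : ℝ, x + 8 / 3 * ((k : ℝ) + a) ^ 2 ≤ 73.34 → x ≤ R k ^ 2) := by
  refine ⟨fun n => (([10.6, 9.7, 9.06, 8.417, 7.77, 7.118] : List ℝ).getD n 0),
    fun n => (([12.279, 11.375, 10.731, 10.084, 9.432, 8.774] : List ℝ).getD n 0),
    by norm_num, ?_, ?_, ?_, ?_, ?_, ?_⟩
  · intro n hn
    have hs2 := sqrt_two_le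
    constructor
    · interval_cases n <;> norm_num <;> linarith
    · interval_cases n <;> norm_num
  · intro n hn
    refine ring_hyp_of ?_ ?_ (ring_ineq_of ?_ ?_) <;> interval_cases n <;> norm_num
  · intro n hn
    refine par_hyp_of ?_ ?_ <;> interval_cases n <;> norm_num
  · intro n hn
    refine far_of_gap ?_
    interval_cases n <;> norm_num
  · intro n hn a x ha0 hna hx hx0
    have hx2 : x ^ 2 ≤ (([10.6, 9.7, 9.06, 8.417, 7.77, 7.118] : List ℝ).getD (n + 1) 0) ^ 2 :=
      pow_le_pow_left₀ hx0 hx 2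
    interval_cases n <;> norm_num at hx2 hna ⊢ <;> nlinarith [mul_nonneg ha0 (sub_nonneg.2 hna)]
  · intro k hk a x hx
    interval_cases k <;> norm_num at hx ⊢ <;> nlinarith [sq_nonneg ((k : ℝ) + a)]

/-- **The schedule about an FCC centre (Case B)**: radii for the layers `0 ≤ n ≤ 5` above (and, by
symmetry, below) the FCC base disc of radius `15/2` through the centre of the ball, the first two
layers inside the FCC zone (the `15/2`-ball), the others with the far corner. [folklore] -/
theorem exists_fcc_schedule' : ∃ P R : ℕ → ℝ, P 0 = 15 / 2 ∧
    (∀ n ≤ 5, Real.sqrt 2 ≤ P n ∧ P n ≤ R n) ∧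
    (∀ n ≤ 5, ∀ r : ℝ, P n < r → r ≤ R n →
      ∃ t : ℝ, 0 < t ∧ 4 / 3 * t ^ 2 < r ^ 2 ∧ r ^ 2 - (4 * t - 4) ≤ P n ^ 2) ∧
    (∀ n < 5, ∀ r M : ℝ, 0 ≤ r → r ≤ P (n + 1) → 0 ≤ M → r ^ 2 ≤ 3 * M ^ 2 →
      r ^ 2 - 2 * M + 4 / 3 ≤ P n ^ 2) ∧
    (∀ n : ℕ, 2 ≤ n → n < 5 → P (n + 1) + 4 / Real.sqrt 3 ≤ R n) ∧
    (∀ n : ℕ, n < 2 → ∀ x : ℝ, x ≤ P (n + 1) → 0 ≤ x → x ^ 2 + 8 / 3 * ((n : ℝ) + 1) ^ 2 ≤ (15 / 2) ^ 2) ∧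
    (∀ n : ℕ, n < 5 → ∀ x : ℝ, x ≤ P (n + 1) → 0 ≤ x → x ^ 2 + 8 / 3 * ((n : ℝ) + 1) ^ 2 ≤ 169) ∧
    (∀ k : ℕ, k ≤ 5 → ∀ x : ℝ, x + 8 / 3 * (k : ℝ) ^ 2 ≤ 73.34 → x ≤ R k ^ 2) := by
  refine ⟨fun n => (([7.5, 7.3, 6.7, 6.037, 5.366, 4.684] : List ℝ).getD n 0),
    fun n => (([9.16, 8.958, 8.351, 7.68, 6.998, 6.303] : List ℝ).getD n 0),
    by norm_num, ?_, ?_, ?_, ?_, ?_, ?_, ?_⟩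
  · intro n hn
    have hs2 := sqrt_two_le
    constructor
    · interval_cases n <;> norm_num <;> linarith
    · interval_cases n <;> norm_num
  · intro n hn
    refine ring_hyp_of ?_ ?_ (ring_ineq_of ?_ ?_) <;> interval_cases n <;> norm_num
  · intro n hn
    refine par_hyp_of ?_ ?_ <;> interval_cases n <;> norm_num
  · intro n hn2 hn
    refine far_of_gap ?_
    interval_cases n <;> norm_num
  · intro n hn x hx hx0
    have hx2 : x ^ 2 ≤ (([7.5, 7.3, 6.7, 6.037, 5.366, 4.684] : List ℝ).getD (n + 1) 0) ^ 2 :=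
      pow_le_pow_left₀ hx0 hx 2
    interval_cases n <;> norm_num at hx2 ⊢ <;> nlinarith
  · intro n hn x hx hx0
    have hx2 : x ^ 2 ≤ (([7.5, 7.3, 6.7, 6.037, 5.366, 4.684] : List ℝ).getD (n + 1) 0) ^ 2 :=
      pow_le_pow_left₀ hx0 hx 2
    interval_cases n <;> norm_num at hx2 ⊢ <;> nlinarith
  · intro k hk x hx
    interval_cases k <;> norm_num at hx ⊢ <;> linarith

/-- **Registered sub-goal `ballPropagation_fccSchedule`** of the crux item (the FCC schedule, in
closed form: `exists_fcc_schedule'`). [folklore] -/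
theorem ballPropagation_fccSchedule :
    ∃ P R : ℕ → ℝ, P 0 = 15 / 2 ∧ (∀ n ≤ 5, Real.sqrt 2 ≤ P n ∧ P n ≤ R n) ∧ (∀ n ≤ 5, ∀ r : ℝ, P n
    < r → r ≤ R n → ∃ t : ℝ, 0 < t ∧ 4 / 3 * t ^ 2 < r ^ 2 ∧ r ^ 2 - (4 * t - 4) ≤ P n ^ 2) ∧ (∀ n
    < 5, ∀ r M : ℝ, 0 ≤ r → r ≤ P (n + 1) → 0 ≤ M → r ^ 2 ≤ 3 * M ^ 2 → r ^ 2 - 2 * M + 4 / 3 ≤ P n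
    ^ 2) ∧ (∀ n : ℕ, 2 ≤ n → n < 5 → P (n + 1) + 4 / Real.sqrt 3 ≤ R n) ∧ (∀ n : ℕ, n < 2 → ∀ x :
    ℝ, x ≤ P (n + 1) → 0 ≤ x → x ^ 2 + 8 / 3 * ((n : ℝ) + 1) ^ 2 ≤ (15 / 2) ^ 2) ∧ (∀ n : ℕ, n < 5
    → ∀ x : ℝ, x ≤ P (n + 1) → 0 ≤ x → x ^ 2 + 8 / 3 * ((n : ℝ) + 1) ^ 2 ≤ 169) ∧ (∀ k : ℕ, k ≤ 5 →
    ∀ x : ℝ, x + 8 / 3 * (k : ℝ) ^ 2 ≤ 73.34 → x ≤ R k ^ 2) :=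
  exists_fcc_schedule'

end Summit.AtomisticToContinuum.Crystallization.Theorems

end
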